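import Summits.QuantumFields.BalabanUV.Beta.GAN24.ContactBorderPairEntryBound
import Summits.QuantumFields.BalabanUV.Beta.GAN24.BornBorderContactPairCount
import Summits.QuantumFields.BalabanUV.Beta.GAN24.ContactGaugeStaircaseCauchyPack

/-!
# `BalabanUV.Beta.GAN24.BornBorderContactPairLineage` — binder row G-an2-4 / (CONV-C), CT-ROUTE, «(V-C)-DIFF» module (C): **THE WEIGHTED CONTACT PAIR OF ONE V LINEAGE** at `d = 3`
# — the top-aligned pair (birth `i+1` in member `k+1`) − (birth `i` in member `k`), `k = i+n+1`, weight `(cE·Lc^8)^{n+1}` against (B)'s two pair entry bounds, every letter AND every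
# DIFFERENCE letter a HYPOTHESIS with explicit constants; the count is leaf-02 g48's `BornLambdaContactLineage.units_le` BY NAME: `|cVH|·(C_b·c_Δ + C_t·T_Δ)·(n+1)·(Lc⁻¹)^{n+1}`

NOT IN PRINT; OUR BOOKKEEPING (G-an2-4 formalisation swarm → CRUX TEAM (2), leaf prover `b2b-balaban-gan24-formalise-leaf-03`, gen 56; «(V-C)-DIFF» INTENT journal `CLAIMS.log`
[LEAF03-G56-ONLINE] ∕ [LEAF03-G56-A1]).  OUR PROOF ATTEMPT of the V twin of leaf-01 g61's BORN-CONTACT-DIFF-PLAN v0 for ONE lineage; [folklore] bookkeeping over this seat's (B)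
`ContactBorderPairEntryBound.abs_contact_border_fm∕mf_pair_le` and (C⁰) `BornBorderContactPairCount.weighted_pair_le_of_cells` (the arithmetic: polynomial, re-centring, leaf-02 g48's `units_le`), leaf-01's
`ContactGaugeStaircase.gauge_eq_staircase ∕ abs_gaugePiece_le` and `BornLambdaLineage.legChain_sub_respStep_of_lt`, gan24-p2 g34's CT-4b Pack §A `gauge_succ_sub_eq_staircase` (the
differenced staircase IS a staircase), leaf-01's `Push3.isFF_push₃`, leaf-02's `ContactBorderCommutator.push₃_reslot_smul`, leaf-04's `Push3LegTelescope.push₃_neg_left` BY NAME.  `d = 3`.  0 `def`, 0 cited facts, 0 `def … : Prop`, 0 sorry; NO estimate of Bałaban's is discharged here — the letters ((N1), the dressed envelopes, the tents) AND the difference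
letters (the undressed-leg pair `c_Δ`, the differenced staircase pieces `8·Lc·c_Δ`, the tent pair `T_Δ`) are HYPOTHESES; (D) `BornBorderContactPairBound` discharges them from CT-4a ∕ CT-4b
Pack §A ∕ CT-4d.  HONEST FRAMING (cell contract, verbatim): «discharging `BetaPertH` makes Bałaban's UV stability UNCONDITIONAL — a real milestone — but is NOT existence of continuum YM
on T⁴ and NOT the Clay problem.»  This file discharges nothing: NOT hBdev, NOT (hS, hSall), NEVER «G-an2-4 closed», NOT (CONV-C), NOT D1, NOT `BetaPertH`.  HONEST DEPENDENCY: continuum YM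
on T⁴ ⇐ BetaPertH ∧ nine spine estimates (0/9 proved); BetaPertH ⇐ (D1) ∧ (D4) ∧ CAP+tail; G-an2-4 gates asym, D1 and NE2/3/4.

WHAT IS PROVED.
* `abs_weight_mul_contact_v_pair_le_three` — **THE WEIGHTED CONTACT PAIR OF ONE V LINEAGE** (`2 ≤ Lc`, in-block root, `|cE| ≤ Lc^4`): towers `(T_i, B_i, λ^{(i,n)})` and
  `(T_{i+1}, B_{i+1}, λ^{(i+1,n)})` (`T_j = legChain (respStepBmSeq ρ Lc) j n`, `B_j = respStep (Lc^j) (Lc^{j+n+1})`; letters (N1) `C₁, κ₁` and dressed envelopes `K_E, κ_E`), abstract multiplier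
  legs `M, M⁺` (fm) and `M′, M′⁺` (mf) under the tent letter `T_b·((Lc^n)^7)⁻¹·e^{−δ_K‖·‖}`; DIFFERENCE letters: `|B_{i+1} − B_i| ≤ c_Δ·(Lc^{5(n+1)})⁻¹·e^{−κ₂‖quo (Lc^{n+1}) u − z‖∞}`, the pieces of
  `λ^{(i+1,n)} − λ^{(i,n)}` (Pack §A's `D`) `≤ 8·Lc·c_Δ·(Lc^{5(n+1)})⁻¹·Lc^s·e^{−κ₂…}`, the tents' differences `T_Δ·((Lc^n)^7)⁻¹·e^{−δ_K…}`.  THEN, with `κ = min (min δ_K κ₁) κ₂`, for ALL `κ′ u′ x z a b`: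
  `|(cE·Lc^8)^{n+1}·([cells of tower i+1] − [cells of tower i]) x z a b| ≤ |cVH|·C_pair·((n+1)·(Lc⁻¹)^{n+1})·e^{−(κ∕96)(|x−u′|₁ + |z−u′|₁)}`,
  `C_pair = 2·Lc^3·((Lc^4)⁻¹·(4·(e^{8κ})²·Cnt)·((2·T_b·C₁·c_Δ + T_Δ·C₁²)·(Lc·(32 + 288·Lc + 512·Lc²)))·Zl 4 (κ∕16))` — the summand shape of (C1) `contact_v_eq_of_succ ∕ _of_top` at births `i+1`, `i`.
-/

open scoped BigOperators
open Literature.MathematicalPhysics.QuantumFieldTheory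
open Literature.MathematicalPhysics.QuantumFieldTheory.LatticeForm (quo)
open Literature.MathematicalPhysics.QuantumFieldTheory.Balaban1983to89
open Literature.MathematicalPhysics.QuantumFieldTheory.Balaban1983to89.Beta
open B4ContourShift (supNorm supNorm_nonneg)
open B12Sec2to5 (l1 l1_nonneg)
open ExpKernelCalculus (MKer Zl Zl_nonneg)
open AffineAveraging (Form0 Form1 Site box toSite unitVec dz)
open AveragingContours (blk)
open AveragingHessianKernels (ell)
open AveragingHessianKernelsRooted (vhSAt)
open OneStepResolventKernel (Fib)
open KKTFluctuationKernel (delta1)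
open BalabanCompositeJets (respStep)
open Summit.QuantumFields.BalabanUV.Beta.AxialProjectorBlockMean (bmGaugeAt)
open Summit.QuantumFields.BalabanUV.Beta.GAN24.RespStepBmDecompLegs (legAct)
open Summit.QuantumFields.BalabanUV.Beta.GAN24.RespStepBmDecompPsi (Psi)
open Summit.QuantumFields.BalabanUV.Beta.GAN24.RespStepBmDecompExact (respStepBmSeq)
open Summit.QuantumFields.BalabanUV.Beta.GAN24.Push4Iter (legChain)
open Summit.QuantumFields.BalabanUV.Beta.GAN24.Push3 (push₃ isFF_push₃)
open Summit.QuantumFields.BalabanUV.Beta.GAN24.Push3LegTelescope (push₃_neg_left abs_le_of_env' summable_of_env')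
open Summit.QuantumFields.BalabanUV.Beta.GAN24.SrecLinearPartEq (reslot)
open Summit.QuantumFields.BalabanUV.Beta.GAN24.ContactGaugeStaircase (gauge_eq_staircase abs_gaugePiece_le)
open Summit.QuantumFields.BalabanUV.Beta.GAN24.ContactGaugeStaircaseCauchyPack (gauge_succ_sub_eq_staircase)
open Summit.QuantumFields.BalabanUV.Beta.GAN24.ContactLambdaCellBound (exp_env_mono_rate)
open Summit.QuantumFields.BalabanUV.Beta.GAN24.ContactBorderCommutator (push₃_reslot_smul)
open Summit.QuantumFields.BalabanUV.Beta.GAN24.ContactBorderPairEntryBound (abs_contact_border_fm_pair_le abs_contact_border_mf_pair_le)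
open Summit.QuantumFields.BalabanUV.Beta.GAN24.BornLambdaLineage (legChain_sub_respStep_of_lt)
open Summit.QuantumFields.BalabanUV.Beta.GAN24.BornBorderContactPairCount (weighted_pair_le_of_cells)

namespace Summit.QuantumFields.BalabanUV.Beta.GAN24.BornBorderContactPairLineage

section Lineage

variable {Lc : ℕ} [NeZero Lc]
variable {rr : Fin (3 + 1) → ℕ} {i n : ℕ} {cE cVH : ℝ} {C₁ κ₁ κ₂ cΔ KE κE CM' CM'p Tb TΔ δK : ℝ}
  {M Mp M' M'p : Fin (3 + 1) → (Fin (3 + 1) → ℤ) → Fin (3 + 1) → (Fin (3 + 1) → ℤ) → ℝ}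

/-- NOT IN PRINT; OUR PROOF ATTEMPT of the V twin of leaf-01 g61's BORN-CONTACT-DIFF-PLAN v0 for ONE lineage, every letter and every DIFFERENCE letter a HYPOTHESIS with explicit constants.
**THE WEIGHTED CONTACT PAIR OF ONE V LINEAGE** (`d = 3`, `2 ≤ Lc`, in-block root; births `i` and `i+1`, `n+1` levels up, top-aligned): towers `T_j = legChain (respStepBmSeq ρ Lc) j n`,
`B_j = respStep (Lc^j) (Lc^{j+n+1})` for `j = i, i+1` (letters: (N1) `C₁, κ₁` — uniform in the base; dressed envelopes `K_E, κ_E`), the route's bond gauge functions (staircases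
`gauge_eq_staircase`, pieces `abs_gaugePiece_le`; their DIFFERENCE the Pack §A staircase `gauge_succ_sub_eq_staircase` with pieces `≤ 8·Lc·c_Δ·(Lc^{5(n+1)})⁻¹·Lc^s·e^{−κ₂‖·‖}` — a HYPOTHESIS),
the undressed-leg pair `|B_{i+1} − B_i| ≤ c_Δ·(Lc^{5(n+1)})⁻¹·e^{−κ₂‖quo (Lc^{n+1}) u − z‖∞}` (a HYPOTHESIS), abstract fm multiplier legs `M, M⁺` (summable in the packed slot) and mf legs `M′, M′⁺`
(bounded, summable), all under the TENT letter `T_b·((Lc^n)^7)⁻¹·e^{−δ_K‖quo (Lc^n) y − ·‖∞}` at the packed sites with tent DIFFERENCES `T_Δ·((Lc^n)^7)⁻¹·e^{−δ_K…}`; table `V = cVH • vhSAt ρ`;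
weight `(cE·Lc^8)^{n+1}`, `|cE| ≤ Lc^4`.  THEN, with `κ = min (min δ_K κ₁) κ₂`, for ALL `κ′ u′ x z a b`:
`|(cE·Lc^8)^{n+1}·(CELLS_{i+1} − CELLS_i) x z a b| ≤ |cVH|·C_pair·((n+1)·(Lc⁻¹)^{n+1})·e^{−(κ∕96)(|x−u′|₁ + |z−u′|₁)}`,
`CELLS_j = (push₃ (−T_j) M_j T_j S − push₃ (−B_j) M_j B_j S) + (push₃ M′_j T_j T_j S′ − push₃ M′_j B_j B_j S′)` (`S = reslot inl inr V`, `S′ = reslot inr inl V`),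
`C_pair = 2·Lc^3·((Lc^4)⁻¹·(4·(e^{8κ})²·Cnt)·((2·T_b·C₁·c_Δ + T_Δ·C₁²)·(Lc·(32 + 288·Lc + 512·Lc²)))·Zl 4 (κ∕16))` — (B) on the `inl∕inl` block, `isFF_push₃` on the others, (C⁰) for the
polynomial, the re-centring and leaf-02's `units_le`. -/
theorem abs_weight_mul_contact_v_pair_le_three (hLc : 2 ≤ Lc) (hrr : rr ∈ box (3 + 1) Lc) (hcE : |cE| ≤ (Lc : ℝ) ^ 4)
    (hN1 : ∀ (m k : ℕ) (μ : Fin (3 + 1)) (z : Site (3 + 1)) (l'' : Fin (3 + 1)) (w' : Site (3 + 1)),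
      |respStep (d := 3) (Lc ^ m) (Lc ^ (m + k + 1)) μ z l'' w'| ≤
        C₁ * ((Lc : ℝ) ^ (5 * (k + 1)))⁻¹ * Real.exp (-(κ₁ * supNorm (quo (Lc ^ (k + 1)) w' - z))))
    (hκ₁ : 0 < κ₁) (hC₁ : 0 ≤ C₁) (hκ₂ : 0 < κ₂) (hcΔ : 0 ≤ cΔ)
    (hBΔ : ∀ (μ : Fin (3 + 1)) (z : Site (3 + 1)) (l : Fin (3 + 1)) (u : Site (3 + 1)),
      |respStep (d := 3) (Lc ^ (i + 1)) (Lc ^ (i + 1 + n + 1)) μ z l u - respStep (d := 3) (Lc ^ i) (Lc ^ (i + n + 1)) μ z l u|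
        ≤ cΔ * ((Lc : ℝ) ^ (5 * (n + 1)))⁻¹ * Real.exp (-(κ₂ * supNorm (quo (Lc ^ (n + 1)) u - z))))
    (hGΔ : ∀ (μ₀ : Fin (3 + 1)) (z₀ : Site (3 + 1)) (s : ℕ), s ≤ n → ∀ u : Site (3 + 1),
      |(fun (s : ℕ) (y : Site (3 + 1)) =>
          -(((Lc : ℝ) ^ ((3 + 1) * s))⁻¹ *
            bmGaugeAt (toSite rr) (legAct (respStep (d := 3) (Lc ^ (i + 1 + s)) (Lc ^ (i + 1 + n + 1))) (delta1 μ₀ z₀)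
              - legAct (respStep (d := 3) (Lc ^ (i + s)) (Lc ^ (i + n + 1))) (delta1 μ₀ z₀)) Lc y)) s (blk (Lc ^ s) u)|
        ≤ 8 * (Lc : ℝ) * cΔ * ((Lc : ℝ) ^ (5 * (n + 1)))⁻¹ * (Lc : ℝ) ^ s * Real.exp (-(κ₂ * supNorm (quo (Lc ^ (n + 1)) u - z₀))))
    (hE : ∀ μ z l u, |legChain (respStepBmSeq (d := 3) (toSite rr) Lc) i n μ z l u| ≤ KE * Real.exp (-(κE * supNorm (quo (Lc ^ (n + 1)) u - z))))
    (hEp : ∀ μ z l u, |legChain (respStepBmSeq (d := 3) (toSite rr) Lc) (i + 1) n μ z l u| ≤ KE * Real.exp (-(κE * supNorm (quo (Lc ^ (n + 1)) u - z))))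
    (hκE : 0 < κE)
    (hMs : ∀ a b μ, Summable fun z => M a b μ z) (hMps : ∀ a b μ, Summable fun z => Mp a b μ z)
    (hMt : ∀ (a : Fin (3 + 1)) (b : Site (3 + 1)) (μ : Fin (3 + 1)) (y : Site (3 + 1)),
      |M a b μ ((Lc : ℤ) • y)| ≤ Tb * ((((Lc : ℝ) ^ n) ^ (2 * 3 + 1))⁻¹) * Real.exp (-(δK * supNorm (quo (Lc ^ n) y - b))))
    (hMpt : ∀ (a : Fin (3 + 1)) (b : Site (3 + 1)) (μ : Fin (3 + 1)) (y : Site (3 + 1)),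
      |Mp a b μ ((Lc : ℤ) • y)| ≤ Tb * ((((Lc : ℝ) ^ n) ^ (2 * 3 + 1))⁻¹) * Real.exp (-(δK * supNorm (quo (Lc ^ n) y - b))))
    (hMΔt : ∀ (a : Fin (3 + 1)) (b : Site (3 + 1)) (μ : Fin (3 + 1)) (y : Site (3 + 1)),
      |Mp a b μ ((Lc : ℤ) • y) - M a b μ ((Lc : ℤ) • y)| ≤ TΔ * ((((Lc : ℝ) ^ n) ^ (2 * 3 + 1))⁻¹) * Real.exp (-(δK * supNorm (quo (Lc ^ n) y - b))))
    (hM'b : ∀ a b μ z, |M' a b μ z| ≤ CM') (hM's : ∀ a b μ, Summable fun z => M' a b μ z)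
    (hM'pb : ∀ a b μ z, |M'p a b μ z| ≤ CM'p) (hM'ps : ∀ a b μ, Summable fun z => M'p a b μ z)
    (hM't : ∀ (a : Fin (3 + 1)) (b : Site (3 + 1)) (μ : Fin (3 + 1)) (y : Site (3 + 1)),
      |M' a b μ ((Lc : ℤ) • y)| ≤ Tb * ((((Lc : ℝ) ^ n) ^ (2 * 3 + 1))⁻¹) * Real.exp (-(δK * supNorm (quo (Lc ^ n) y - b))))
    (hM'Δt : ∀ (a : Fin (3 + 1)) (b : Site (3 + 1)) (μ : Fin (3 + 1)) (y : Site (3 + 1)),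
      |M'p a b μ ((Lc : ℤ) • y) - M' a b μ ((Lc : ℤ) • y)| ≤ TΔ * ((((Lc : ℝ) ^ n) ^ (2 * 3 + 1))⁻¹) * Real.exp (-(δK * supNorm (quo (Lc ^ n) y - b))))
    (hδK : 0 < δK) (hTb : 0 ≤ Tb) (hTΔ : 0 ≤ TΔ)
    (κ' : Fin (3 + 1)) (u' x z : Site (3 + 1)) (a b : Fib 3) :
    |(cE * (Lc : ℝ) ^ (2 * (3 + 1))) ^ (n + 1) *
        (((push₃ (-legChain (respStepBmSeq (d := 3) (toSite rr) Lc) (i + 1) n) Mp (legChain (respStepBmSeq (d := 3) (toSite rr) Lc) (i + 1) n)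
                (reslot Sum.inl Sum.inr fun κ u => cVH • vhSAt (toSite rr) 3 Lc rfl κ u) κ' u' x z a b
              - push₃ (-respStep (d := 3) (Lc ^ (i + 1)) (Lc ^ (i + 1 + n + 1))) Mp (respStep (d := 3) (Lc ^ (i + 1)) (Lc ^ (i + 1 + n + 1)))
                (reslot Sum.inl Sum.inr fun κ u => cVH • vhSAt (toSite rr) 3 Lc rfl κ u) κ' u' x z a b)
            + (push₃ M'p (legChain (respStepBmSeq (d := 3) (toSite rr) Lc) (i + 1) n) (legChain (respStepBmSeq (d := 3) (toSite rr) Lc) (i + 1) n)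
                (reslot Sum.inr Sum.inl fun κ u => cVH • vhSAt (toSite rr) 3 Lc rfl κ u) κ' u' x z a b
              - push₃ M'p (respStep (d := 3) (Lc ^ (i + 1)) (Lc ^ (i + 1 + n + 1))) (respStep (d := 3) (Lc ^ (i + 1)) (Lc ^ (i + 1 + n + 1)))
                (reslot Sum.inr Sum.inl fun κ u => cVH • vhSAt (toSite rr) 3 Lc rfl κ u) κ' u' x z a b))
          - ((push₃ (-legChain (respStepBmSeq (d := 3) (toSite rr) Lc) i n) M (legChain (respStepBmSeq (d := 3) (toSite rr) Lc) i n)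
                (reslot Sum.inl Sum.inr fun κ u => cVH • vhSAt (toSite rr) 3 Lc rfl κ u) κ' u' x z a b
              - push₃ (-respStep (d := 3) (Lc ^ i) (Lc ^ (i + n + 1))) M (respStep (d := 3) (Lc ^ i) (Lc ^ (i + n + 1)))
                (reslot Sum.inl Sum.inr fun κ u => cVH • vhSAt (toSite rr) 3 Lc rfl κ u) κ' u' x z a b)
            + (push₃ M' (legChain (respStepBmSeq (d := 3) (toSite rr) Lc) i n) (legChain (respStepBmSeq (d := 3) (toSite rr) Lc) i n)
                (reslot Sum.inr Sum.inl fun κ u => cVH • vhSAt (toSite rr) 3 Lc rfl κ u) κ' u' x z a b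
              - push₃ M' (respStep (d := 3) (Lc ^ i) (Lc ^ (i + n + 1))) (respStep (d := 3) (Lc ^ i) (Lc ^ (i + n + 1)))
                (reslot Sum.inr Sum.inl fun κ u => cVH • vhSAt (toSite rr) 3 Lc rfl κ u) κ' u' x z a b)))|
      ≤ |cVH| * (2 * ((Lc : ℝ) ^ 3 * (((Lc : ℝ) ^ (3 + 1))⁻¹ * (((3 : ℝ) + 1) * (Real.exp (2 * ((3 : ℝ) + 1) * min (min δK κ₁) κ₂) ^ 2 *
              (((2 * Lc : ℕ) : ℝ) ^ (3 + 1) * (((3 + 1 : ℕ) : ℝ) * ((Lc : ℝ) ^ (3 + 1) * (ell (3 + 1) Lc : ℝ))))))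
            * ((2 * Tb * C₁ * cΔ + TΔ * C₁ ^ 2) * ((Lc : ℝ) * (32 + 288 * Lc + 512 * (Lc : ℝ) ^ 2)))
            * Zl (3 + 1) (min (min δK κ₁) κ₂ / (4 * ((3 : ℝ) + 1))))))
          * ((((n : ℝ) + 1)) * ((Lc : ℝ)⁻¹) ^ (n + 1))
          * Real.exp (-(min (min δK κ₁) κ₂ / 12 / 2 / ((3 : ℝ) + 1)) * (l1 (x - u') + l1 (z - u'))) := by
  have hLc1 : 1 ≤ Lc := le_trans (by norm_num) hLc
  have hL : (0 : ℝ) < (Lc : ℝ) := Nat.cast_pos.2 (Nat.pos_of_ne_zero (NeZero.ne Lc))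
  have hLn1 : 1 ≤ Lc ^ (n + 1) := Nat.one_le_pow _ _ hLc1
  set κ : ℝ := min (min δK κ₁) κ₂ with hκdef
  have hκ : 0 < κ := lt_min (lt_min hδK hκ₁) hκ₂
  have hκK : κ ≤ δK := (min_le_left _ _).trans (min_le_left _ _)
  have hκ1 : κ ≤ κ₁ := (min_le_left _ _).trans (min_le_right _ _)
  have hκ2 : κ ≤ κ₂ := min_le_right _ _
  -- the field-slot letters of both towers at the common rate `κ`
  set T := legChain (respStepBmSeq (d := 3) (toSite rr) Lc) i n with hTdef
  set B := respStep (d := 3) (Lc ^ i) (Lc ^ (i + n + 1)) with hBdef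
  set Tp := legChain (respStepBmSeq (d := 3) (toSite rr) Lc) (i + 1) n with hTpdef
  set Bp := respStep (d := 3) (Lc ^ (i + 1)) (Lc ^ (i + 1 + n + 1)) with hBpdef
  have hT : ∀ μ z' l u, |T μ z' l u| ≤ KE := abs_le_of_env' hκE.le hE
  have hTs : ∀ μ z' l, Summable fun u => T μ z' l u := summable_of_env' hLn1 hκE hE
  have hTp : ∀ μ z' l u, |Tp μ z' l u| ≤ KE := abs_le_of_env' hκE.le hEp
  have hTps : ∀ μ z' l, Summable fun u => Tp μ z' l u := summable_of_env' hLn1 hκE hEp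
  have hB : ∀ μ z' l u, |B μ z' l u| ≤ C₁ * ((Lc : ℝ) ^ (5 * (n + 1)))⁻¹ * Real.exp (-(κ * supNorm (quo (Lc ^ (n + 1)) u - z'))) := by
    intro μ z' l u
    exact (hN1 i n μ z' l u).trans (mul_le_mul_of_nonneg_left (exp_env_mono_rate hκ1 (supNorm_nonneg _)) (by positivity))
  have hBp : ∀ μ z' l u, |Bp μ z' l u| ≤ C₁ * ((Lc : ℝ) ^ (5 * (n + 1)))⁻¹ * Real.exp (-(κ * supNorm (quo (Lc ^ (n + 1)) u - z'))) := by
    intro μ z' l u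
    have h := hN1 (i + 1) n μ z' l u
    exact h.trans (mul_le_mul_of_nonneg_left (exp_env_mono_rate hκ1 (supNorm_nonneg _)) (by positivity))
  have hBΔ' : ∀ μ z' l u, |Bp μ z' l u - B μ z' l u| ≤ cΔ * ((Lc : ℝ) ^ (5 * (n + 1)))⁻¹ * Real.exp (-(κ * supNorm (quo (Lc ^ (n + 1)) u - z'))) := by
    intro μ z' l u
    exact (hBΔ μ z' l u).trans (mul_le_mul_of_nonneg_left (exp_env_mono_rate hκ2 (supNorm_nonneg _)) (by positivity))
  -- the gauge functions of both towers and their staircase pieces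
  set lam : Fin (3 + 1) → Site (3 + 1) → Site (3 + 1) → ℝ := fun μ z' =>
    Psi (toSite rr) Lc i n (delta1 μ z') - bmGaugeAt (toSite rr) (respStep (d := 3) (Lc ^ i) (Lc ^ (i + n + 1)) μ z') Lc with hlamdef
  set Gp : Fin (3 + 1) → Site (3 + 1) → ℕ → Site (3 + 1) → ℝ := fun μ₀ z₀ s y =>
    if s = 0 then -bmGaugeAt (toSite rr) (respStep (d := 3) (Lc ^ i) (Lc ^ (i + n + 1)) μ₀ z₀) Lc y
    else -(((Lc : ℝ) ^ ((3 + 1) * s))⁻¹ *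
      bmGaugeAt (toSite rr) (legAct (respStep (d := 3) (Lc ^ (i + s)) (Lc ^ (i + n + 1))) (delta1 μ₀ z₀)) Lc y) with hGpdef
  set lamq : Fin (3 + 1) → Site (3 + 1) → Site (3 + 1) → ℝ := fun μ z' =>
    Psi (toSite rr) Lc (i + 1) n (delta1 μ z') - bmGaugeAt (toSite rr) (respStep (d := 3) (Lc ^ (i + 1)) (Lc ^ (i + 1 + n + 1)) μ z') Lc with hlamqdef
  set Gq : Fin (3 + 1) → Site (3 + 1) → ℕ → Site (3 + 1) → ℝ := fun μ₀ z₀ s y =>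
    if s = 0 then -bmGaugeAt (toSite rr) (respStep (d := 3) (Lc ^ (i + 1)) (Lc ^ (i + 1 + n + 1)) μ₀ z₀) Lc y
    else -(((Lc : ℝ) ^ ((3 + 1) * s))⁻¹ *
      bmGaugeAt (toSite rr) (legAct (respStep (d := 3) (Lc ^ (i + 1 + s)) (Lc ^ (i + 1 + n + 1))) (delta1 μ₀ z₀)) Lc y) with hGqdef
  set GΔ : Fin (3 + 1) → Site (3 + 1) → ℕ → Site (3 + 1) → ℝ := fun μ₀ z₀ s y =>
    -(((Lc : ℝ) ^ ((3 + 1) * s))⁻¹ *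
      bmGaugeAt (toSite rr) (legAct (respStep (d := 3) (Lc ^ (i + 1 + s)) (Lc ^ (i + 1 + n + 1))) (delta1 μ₀ z₀)
        - legAct (respStep (d := 3) (Lc ^ (i + s)) (Lc ^ (i + n + 1))) (delta1 μ₀ z₀)) Lc y) with hGΔdef
  have hTB : T - B = fun μ z' l u => dz (lam μ z') l u := by
    have hik : i < i + n + 1 := by omega
    have h := legChain_sub_respStep_of_lt (d := 3) (Lc := Lc) hrr hik
    rw [show i + n + 1 - 1 - i = n by omega] at h
    exact h
  have hTBp : Tp - Bp = fun μ z' l u => dz (lamq μ z') l u := by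
    have hik : i + 1 < i + 1 + n + 1 := by omega
    have h := legChain_sub_respStep_of_lt (d := 3) (Lc := Lc) hrr hik
    rw [show i + 1 + n + 1 - 1 - (i + 1) = n by omega] at h
    exact h
  have hψ : ∀ (μ₀ : Fin (3 + 1)) (z₀ u : Site (3 + 1)), lam μ₀ z₀ u = ∑ s ∈ Finset.range (n + 1), Gp μ₀ z₀ s (blk (Lc ^ s) u) := by
    intro μ₀ z₀ u
    have h := gauge_eq_staircase (Lc := Lc) (toSite rr) i n μ₀ z₀ u
    simp only [hlamdef, hGpdef, Pi.sub_apply] at h ⊢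
    exact h
  have hψq : ∀ (μ₀ : Fin (3 + 1)) (z₀ u : Site (3 + 1)), lamq μ₀ z₀ u = ∑ s ∈ Finset.range (n + 1), Gq μ₀ z₀ s (blk (Lc ^ s) u) := by
    intro μ₀ z₀ u
    have h := gauge_eq_staircase (Lc := Lc) (toSite rr) (i + 1) n μ₀ z₀ u
    simp only [hlamqdef, hGqdef, Pi.sub_apply] at h ⊢
    exact h
  have hψΔ : ∀ (μ₀ : Fin (3 + 1)) (z₀ u : Site (3 + 1)), lamq μ₀ z₀ u - lam μ₀ z₀ u = ∑ s ∈ Finset.range (n + 1), GΔ μ₀ z₀ s (blk (Lc ^ s) u) := by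
    intro μ₀ z₀ u
    have h := gauge_succ_sub_eq_staircase (Lc := Lc) (toSite rr) i n μ₀ z₀ u
    simp only [hlamqdef, hlamdef, hGΔdef, Pi.sub_apply] at h ⊢
    exact h
  have hG : ∀ (μ₀ : Fin (3 + 1)) (z₀ : Site (3 + 1)) (s : ℕ), s ≤ n → ∀ u : Site (3 + 1),
      |Gp μ₀ z₀ s (blk (Lc ^ s) u)| ≤ (8 * (Lc : ℝ) * C₁ * ((Lc : ℝ) ^ (5 * (n + 1)))⁻¹) * (Lc : ℝ) ^ s * Real.exp (-(κ * supNorm (quo (Lc ^ (n + 1)) u - z₀))) := by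
    intro μ₀ z₀ s hs u
    have h := abs_gaugePiece_le (Lc := Lc) hN1 hrr i n μ₀ z₀ hs u
    simp only [hGpdef] at h ⊢
    refine h.trans (mul_le_mul_of_nonneg_left (exp_env_mono_rate hκ1 (supNorm_nonneg _)) (by positivity))
  have hGq : ∀ (μ₀ : Fin (3 + 1)) (z₀ : Site (3 + 1)) (s : ℕ), s ≤ n → ∀ u : Site (3 + 1),
      |Gq μ₀ z₀ s (blk (Lc ^ s) u)| ≤ (8 * (Lc : ℝ) * C₁ * ((Lc : ℝ) ^ (5 * (n + 1)))⁻¹) * (Lc : ℝ) ^ s * Real.exp (-(κ * supNorm (quo (Lc ^ (n + 1)) u - z₀))) := by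
    intro μ₀ z₀ s hs u
    have h := abs_gaugePiece_le (Lc := Lc) hN1 hrr (i + 1) n μ₀ z₀ hs u
    simp only [hGqdef] at h ⊢
    refine h.trans (mul_le_mul_of_nonneg_left (exp_env_mono_rate hκ1 (supNorm_nonneg _)) (by positivity))
  have hGΔ' : ∀ (μ₀ : Fin (3 + 1)) (z₀ : Site (3 + 1)) (s : ℕ), s ≤ n → ∀ u : Site (3 + 1),
      |GΔ μ₀ z₀ s (blk (Lc ^ s) u)| ≤ (8 * (Lc : ℝ) * cΔ * ((Lc : ℝ) ^ (5 * (n + 1)))⁻¹) * (Lc : ℝ) ^ s * Real.exp (-(κ * supNorm (quo (Lc ^ (n + 1)) u - z₀))) := by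
    intro μ₀ z₀ s hs u
    have h := hGΔ μ₀ z₀ s hs u
    simp only [hGΔdef] at h ⊢
    refine h.trans (mul_le_mul_of_nonneg_left (exp_env_mono_rate hκ2 (supNorm_nonneg _)) (by positivity))
  -- the tents and tent differences at the common rate
  have tent_mono : ∀ {Q : ℝ} {bb : Site (3 + 1)} {y : Site (3 + 1)} {v : ℝ}, 0 ≤ Q →
      v ≤ Q * ((((Lc : ℝ) ^ n) ^ (2 * 3 + 1))⁻¹) * Real.exp (-(δK * supNorm (quo (Lc ^ n) y - bb))) →
      v ≤ (Q * ((((Lc : ℝ) ^ n) ^ (2 * 3 + 1))⁻¹)) * Real.exp (-(κ * supNorm (quo (Lc ^ n) y - bb))) := fun hQ hv =>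
    hv.trans (mul_le_mul_of_nonneg_left (exp_env_mono_rate hκK (supNorm_nonneg _)) (by positivity))
  have hMt' := fun (a : Fin (3 + 1)) (bb : Site (3 + 1)) (μ : Fin (3 + 1)) (y : Site (3 + 1)) => tent_mono hTb (hMt a bb μ y)
  have hMpt' := fun (a : Fin (3 + 1)) (bb : Site (3 + 1)) (μ : Fin (3 + 1)) (y : Site (3 + 1)) => tent_mono hTb (hMpt a bb μ y)
  have hMΔt' := fun (a : Fin (3 + 1)) (bb : Site (3 + 1)) (μ : Fin (3 + 1)) (y : Site (3 + 1)) => tent_mono hTΔ (hMΔt a bb μ y)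
  have hM't' := fun (a : Fin (3 + 1)) (bb : Site (3 + 1)) (μ : Fin (3 + 1)) (y : Site (3 + 1)) => tent_mono hTb (hM't a bb μ y)
  have hM'Δt' := fun (a : Fin (3 + 1)) (bb : Site (3 + 1)) (μ : Fin (3 + 1)) (y : Site (3 + 1)) => tent_mono hTΔ (hM'Δt a bb μ y)
  -- the scale `cVH` and the sign of the fm pushes out; entries
  simp only [push₃_reslot_smul, push₃_neg_left]
  simp only [Pi.smul_apply, Pi.neg_apply, smul_eq_mul]
  set P₁ := push₃ T M T (reslot Sum.inl Sum.inr (vhSAt (toSite rr) 3 Lc rfl)) κ' u' with hP₁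
  set P₂ := push₃ B M B (reslot Sum.inl Sum.inr (vhSAt (toSite rr) 3 Lc rfl)) κ' u' with hP₂
  set P₃ := push₃ M' T T (reslot Sum.inr Sum.inl (vhSAt (toSite rr) 3 Lc rfl)) κ' u' with hP₃
  set P₄ := push₃ M' B B (reslot Sum.inr Sum.inl (vhSAt (toSite rr) 3 Lc rfl)) κ' u' with hP₄
  set Q₁ := push₃ Tp Mp Tp (reslot Sum.inl Sum.inr (vhSAt (toSite rr) 3 Lc rfl)) κ' u' with hQ₁
  set Q₂ := push₃ Bp Mp Bp (reslot Sum.inl Sum.inr (vhSAt (toSite rr) 3 Lc rfl)) κ' u' with hQ₂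
  set Q₃ := push₃ M'p Tp Tp (reslot Sum.inr Sum.inl (vhSAt (toSite rr) 3 Lc rfl)) κ' u' with hQ₃
  set Q₄ := push₃ M'p Bp Bp (reslot Sum.inr Sum.inl (vhSAt (toSite rr) 3 Lc rfl)) κ' u' with hQ₄
  have e : (cE * (Lc : ℝ) ^ (2 * (3 + 1))) ^ (n + 1) *
        ((cVH * -Q₁ x z a b - cVH * -Q₂ x z a b + (cVH * Q₃ x z a b - cVH * Q₄ x z a b))
          - (cVH * -P₁ x z a b - cVH * -P₂ x z a b + (cVH * P₃ x z a b - cVH * P₄ x z a b)))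
      = ((cE * (Lc : ℝ) ^ (2 * (3 + 1))) ^ (n + 1) * cVH) *
          (((Q₃ x z a b - Q₄ x z a b) - (P₃ x z a b - P₄ x z a b)) - ((Q₁ x z a b - Q₂ x z a b) - (P₁ x z a b - P₂ x z a b))) := by ring
  rw [e, abs_mul, abs_mul, abs_pow]
  -- the tables are ff-valued
  have hS1 : Push4.IsFF P₁ := isFF_push₃ (l := T) (r := M) (w := T) (reslot Sum.inl Sum.inr (vhSAt (toSite rr) 3 Lc rfl)) κ' u'
  have hS2 : Push4.IsFF P₂ := isFF_push₃ (l := B) (r := M) (w := B) (reslot Sum.inl Sum.inr (vhSAt (toSite rr) 3 Lc rfl)) κ' u'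
  have hS3 : Push4.IsFF P₃ := isFF_push₃ (l := M') (r := T) (w := T) (reslot Sum.inr Sum.inl (vhSAt (toSite rr) 3 Lc rfl)) κ' u'
  have hS4 : Push4.IsFF P₄ := isFF_push₃ (l := M') (r := B) (w := B) (reslot Sum.inr Sum.inl (vhSAt (toSite rr) 3 Lc rfl)) κ' u'
  have hR1 : Push4.IsFF Q₁ := isFF_push₃ (l := Tp) (r := Mp) (w := Tp) (reslot Sum.inl Sum.inr (vhSAt (toSite rr) 3 Lc rfl)) κ' u'
  have hR2 : Push4.IsFF Q₂ := isFF_push₃ (l := Bp) (r := Mp) (w := Bp) (reslot Sum.inl Sum.inr (vhSAt (toSite rr) 3 Lc rfl)) κ' u'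
  have hR3 : Push4.IsFF Q₃ := isFF_push₃ (l := M'p) (r := Tp) (w := Tp) (reslot Sum.inr Sum.inl (vhSAt (toSite rr) 3 Lc rfl)) κ' u'
  have hR4 : Push4.IsFF Q₄ := isFF_push₃ (l := M'p) (r := Bp) (w := Bp) (reslot Sum.inr Sum.inl (vhSAt (toSite rr) 3 Lc rfl)) κ' u'
  have hZ : 0 ≤ Zl (3 + 1) (κ / (4 * ((3 : ℝ) + 1))) := Zl_nonneg (by positivity)
  have hRHS0 : 0 ≤ |cVH| * (2 * ((Lc : ℝ) ^ 3 * (((Lc : ℝ) ^ (3 + 1))⁻¹ * (((3 : ℝ) + 1) * (Real.exp (2 * ((3 : ℝ) + 1) * κ) ^ 2 *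
              (((2 * Lc : ℕ) : ℝ) ^ (3 + 1) * (((3 + 1 : ℕ) : ℝ) * ((Lc : ℝ) ^ (3 + 1) * (ell (3 + 1) Lc : ℝ))))))
            * ((2 * Tb * C₁ * cΔ + TΔ * C₁ ^ 2) * ((Lc : ℝ) * (32 + 288 * Lc + 512 * (Lc : ℝ) ^ 2)))
            * Zl (3 + 1) (κ / (4 * ((3 : ℝ) + 1))))))
          * ((((n : ℝ) + 1)) * ((Lc : ℝ)⁻¹) ^ (n + 1))
          * Real.exp (-(κ / 12 / 2 / ((3 : ℝ) + 1)) * (l1 (x - u') + l1 (z - u'))) := by positivity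
  rcases a with α | μa
  · rcases b with β | νb
    · -- the cells: (B) on the fm pair and on the mf pair
      have hfm := abs_contact_border_fm_pair_le (d := 3) (Lc := Lc) (rr := rr) (n := n)
        (αg := 8 * (Lc : ℝ) * C₁ * ((Lc : ℝ) ^ (5 * (n + 1)))⁻¹) (αΔ := 8 * (Lc : ℝ) * cΔ * ((Lc : ℝ) ^ (5 * (n + 1)))⁻¹)
        (KB := C₁ * ((Lc : ℝ) ^ (5 * (n + 1)))⁻¹) (KΔ := cΔ * ((Lc : ℝ) ^ (5 * (n + 1)))⁻¹)
        (Tb := Tb * ((((Lc : ℝ) ^ n) ^ (2 * 3 + 1))⁻¹)) (TΔ := TΔ * ((((Lc : ℝ) ^ n) ^ (2 * 3 + 1))⁻¹))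
        (lam := lam) (lamp := lamq) (G := Gp) (Gp := Gq) (GΔ := GΔ) hLc1 hrr hκ (by positivity) (by positivity) (by positivity) (by positivity)
        (by positivity) (by positivity) hT hTs hB hTB hψ hG hTp hTps hBp hTBp hψq hGq hBΔ' hψΔ hGΔ' hMs hMps hMt' hMpt' hMΔt' κ' u' x z α β
      have hmf := abs_contact_border_mf_pair_le (d := 3) (Lc := Lc) (rr := rr) (n := n)
        (αg := 8 * (Lc : ℝ) * C₁ * ((Lc : ℝ) ^ (5 * (n + 1)))⁻¹) (αΔ := 8 * (Lc : ℝ) * cΔ * ((Lc : ℝ) ^ (5 * (n + 1)))⁻¹)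
        (KB := C₁ * ((Lc : ℝ) ^ (5 * (n + 1)))⁻¹) (KΔ := cΔ * ((Lc : ℝ) ^ (5 * (n + 1)))⁻¹)
        (Tb := Tb * ((((Lc : ℝ) ^ n) ^ (2 * 3 + 1))⁻¹)) (TΔ := TΔ * ((((Lc : ℝ) ^ n) ^ (2 * 3 + 1))⁻¹))
        (lam := lam) (lamp := lamq) (G := Gp) (Gp := Gq) (GΔ := GΔ) hLc1 hrr hκ (by positivity) (by positivity) (by positivity) (by positivity)
        (by positivity) (by positivity) hT hTs hB hTB hψ hG hTp hTps hBp hTBp hψq hGq hBΔ' hψΔ hGΔ' hM'b hM's hM'pb hM'ps hM't' hM'Δt' κ' u' x z α β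
      exact weighted_pair_le_of_cells hcE hC₁ hcΔ hTb hTΔ hκ x z u' hfm hmf
    · -- `b = inr`: every push is ff-valued
      rw [hS1.2 x z (Sum.inl α) νb, hS2.2 x z (Sum.inl α) νb, hS3.2 x z (Sum.inl α) νb, hS4.2 x z (Sum.inl α) νb,
        hR1.2 x z (Sum.inl α) νb, hR2.2 x z (Sum.inl α) νb, hR3.2 x z (Sum.inl α) νb, hR4.2 x z (Sum.inl α) νb]
      simp only [sub_self, abs_zero, mul_zero]
      exact hRHS0
  · rw [hS1.1 x z μa b, hS2.1 x z μa b, hS3.1 x z μa b, hS4.1 x z μa b, hR1.1 x z μa b, hR2.1 x z μa b, hR3.1 x z μa b, hR4.1 x z μa b]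
    simp only [sub_self, abs_zero, mul_zero]
    exact hRHS0

end Lineage

end Summit.QuantumFields.BalabanUV.Beta.GAN24.BornBorderContactPairLineage
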